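import Mathlib.Tactic.Linarith
import Mathlib.Tactic.Ring
import Mathlib.Tactic.NormNum
import Mathlib.Tactic.IntervalCases
import Mathlib.Algebra.BigOperators.Group.Finset.Basic
import HarnessLib

/-!
# The (0,1) cell of the ι-window, EXCLUSION side, IV: the QUOT-DIMENSION SIEVE AT AN ι-FIXED SINGULAR POINT of a theta complete
# intersection — integer skeleton (second-layer counts, generator bounds, the sieve inequalities, balanced Hilbert functions, (P)-counts)

Family `hodge`, layer `Literature/AlgebraicGeometry/HodgeTheory`. Companion to `SemiregularityIotaWindowVoid.lean` (pv1 line, gens 11–15: the H2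
census, (TS), (TM), THEOREM (R-tan), the fixed-node index) and to `SemiregularityQuotDimensionSieve.lean` (pv3-g9: the Quot-dimension sieve (QD)
on the existence side), with the SAME dictionary: `X` a very general ppav fourfold, `ι = −1`, a would-be `(0,1)` object `F = ker(E ↠ T)` of shape
(4.5)(a) with flat rank-2 hull `E`, support `S_a = Θ_a ∩ Θ_{−a}`, 0-dimensional torsion `T₀` (length `t`), canonical `F' := ker(E ↠ T/T₀)`;
by the certified TORSION-MODULI lemma `T₀` sits at `ι`-fixed points of `S_a`, i.e. at 2-torsion points `x ∈ S_a`, where `Θ_a` and `Θ_{−a}`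
are tangent: locally `S = V(x₄, q) ⊂ (𝔸⁴, 0)` with all coordinates `ι`-odd and `q` EVEN of order `≥ 2` (A₁: `x₁x₂ − x₃²`; A₃; corank 2).
Ladder note `papers/HodgeConjecture/hodge-weil-ladder` (packet `run/shared/lean/b2b/hodge-weil/`), CLAIM TABLE v24/v25 (LADDER C162 / C168) row
pv1-g16, report `b2b-hweil-pv1-g16/H2-ZERO-ONE-4.md` (§§1–5, 7), script `code/pv1-g16/qd_node.py` (corroboration only). Def-free, fully proved
ELEMENTARY statements (integer bookkeeping and one alternating sum); the module theory is in the docstrings and the report. HONEST FRAMING: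
census / negative results about one cell of the ladder's H2 test on the exclusion side; no case of the Hodge conjecture is proved; nothing here is
a rung; no statement of [Markman 2025] is used; NOTHING here depends on the local Poisson-liftability criterion (LP) or on 'ker ob = ann(ch)'.

THE HULLS (report §1). `A = k[[x₁..x₄]]`, `R = 𝒪_{S,x} = A/(x₄, q)`, `E_x = A e₊ ⊕ A e₋` (balanced fibre: `sign(f e₊) = parity f`,
`sign(g e₋) = −parity g`), `N` Cartier at `x`, `φ : E → N ≅ R`, `φ(e₊) = s₁` EVEN, `φ(e₋) = s₂` ODD, base ideal `𝔞 = (s₁, s₂)`. At a base point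
`F'_x = M_𝔞 = 𝓘_S E + A·κ`, `κ = s₂e₊ − s₁e₋`, minimal generators `x₄e₊ (−), qe₊ (+), x₄e₋ (+), qe₋ (−), κ (−)` — signs `(m₊, m₋) = (2, 3)` —
with the four relations `q·(x₄e₊) − x₄·(qe₊)`, `q·(x₄e₋) − x₄·(qe₋)`, `x₄κ − s₂·(x₄e₊) + s₁·(x₄e₋)`, `qκ − s₂·(qe₊) + s₁·(qe₋)`, whose
LINEAR PARTS (`q, s₁ ∈ 𝔪²`; `l₂ :=` linear part of `s₂ ≠ 0`) are four independent vectors of `𝔪/𝔪² ⊗ k⁵` of signs `−, +, +, −`; hence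
`𝔪M/𝔪²M` has sign-dimensions `(4·3 − 2, 4·2 − 2) = (10, 6)` and `M/𝔪²M` has `(12, 9)` (`secondLayer_base`). At a non-base point
`F'_x = M⁰ = 𝓘_S e₊ ⊕ A e'` with generators `e' (−), x₄e₊ (−), qe₊ (+)`, one Koszul relation: `(m₊, m₋) = (1, 2)`, second layer `(8, 3)`,
`M⁰/𝔪²M⁰ = (9, 5)` (`secondLayer_nobase`).

THEOREM A (report §2; `altSum_range_even` is its homogeneous sanity check). For `𝔞 = (s₁ even, s₂ odd with linear part)` of finite colength in
`R = k[[x₁,x₂,x₃]]/(q)`, `q` even: `R/𝔞` is BALANCED — `R/(s₂) ≅ k[[y₁,y₂]] =: P` ι-equivariantly (odd implicit function), `R/𝔞 = P/(f,h)` with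
`f, h` EVEN, and `P = P₊ ⊕ P₋` over the invariant ring `P₊ ≅ A₁`, `P₋` MCM of rank 1, so `ℓ(P₋/(f,h)P₋) = e((f,h); P₊) = ℓ(P₊/(f,h)P₊)`
[Bruns–Herzog §4.7]. Hence the torsion at `x` has sign-lengths `(n, n)` (index balance `n₊ − n₋ = m₊ − m₋`, `balanced_of_index`), `t_x = 2n` is
even, and with THEOREM (R-tan)'s `t ≥ 2` and the Hodge budget `24(2t − 4) ≤ 256` (`hodgeBudget_seven`, `torsionLength_cases`): `n ∈ {1,2,3}`.

THE SIEVE (report §3; the moves (S)/(Ψ)/(P) are pv3-g9's, certified R288). For `F ∈ Quot^ι_x(M; n,n)`, `T₀ = M/F` with top signs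
`(a₊, a₋)`, `T₀/𝔪²T₀` of signs `(p₊, p₋)`: `μ₊(F) ≥ c₊ − p₊ − 4(m₋ − a₋)`, `μ₋(F) ≥ c₋ − p₋ − 4(m₊ − a₊)` (`muBound`: `F/𝔪F ↠
F̄/𝔪F̄`, `F̄ = (F + 𝔪²M)/𝔪²M` of dimension `c − p`, `𝔪F̄` spanned by the four odd coordinates times the `(m − a)` top classes of the opposite
sign); (S) kills unless [(+) ∈ soc ⟹ that bound ≤ 1] and [(−) ∈ soc ⟹ …], i.e. (`sievePlus_survivor`, `sieveMinus_survivor`, with `p ≤ n ≤ 3`)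
for `M_𝔞`: (+) ∈ soc ⟹ `a₋ = 0 ∨ (a₋ = 1 ∧ p₊ = 3)`, (−) ∈ soc ⟹ `a₊ = 0`; for `M⁰` both give `a = 0` on the opposite sign. (Ψ) over `M₁ = 𝔪M`
gives `d ≥ (m₊ − a₊)s₊ + (m₋ − a₋)s₋`. The cyclic shapes are the balanced Hilbert functions `hf_balanced_two/four/six`. What survives — `(+|−−|+)`,
`(++|−−−|+)`, `(−−|+++|−)`, `(+|−−|+|−|+)` on `M_𝔞`; `(+|−−|+)`, `(−|++|−)`, `(+|−−−|++)`, `(+|−−|+|−|+)`, `(−|++|−|+|−)`, `(−−|+++|−)` on `M⁰` —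
is killed by (P) = `hom − aut` with the counts of `pCounts_base` / `pCounts_nobase`. THEOREM B / B⁰: every point of `Quot^ι_x(M; n, n)`,
`n ≤ 3`, has local dimension `≥ 2`; by (QD) LEMMA 1.1 (certified R288) `e₁^ι(F) ≥ 2`: (R-node)′ — `(4,4)`, `(6,8)`, cases (I) and (II), every base
ideal — is CLOSED, stratum (N) is VOID, (8.3.3)-free up to (C2)'s curve-part clause; likewise every configuration with torsion at a fixed point where
`N` is Cartier.

What is NOT here: the module-theoretic proofs (report §§1–4, 7); anything about objects; any (LP) statement. 0 unconditional rungs above the floor.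
-/

namespace Literature.AlgebraicGeometry.HodgeTheory

section H2QuotSieveFixedNode

open Finset in
/-- THEOREM A, HOMOGENEOUS SANITY CHECK (report §2.1, last sentence): for a complete intersection of two forms of degrees `2α`, `β` in
`k[y₁,y₂]` with `ι = −1`, the signed length `m₊ − m₋` is the Hilbert series `(1 − z^{2α})(1 − z^{β})/(1 − z)²` at `z = −1`, and the first
factor `(1 − z^{2α})/(1 − z) = Σ_{i<2α} z^i` vanishes there: `Σ_{i<2α} (−1)^i = 0`. [folklore] -/
theorem altSum_range_even (a : ℕ) : ∑ i ∈ range (2 * a), (-1 : ℤ) ^ i = 0 := by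
  induction a with
  | zero => simp
  | succ n ih =>
    rw [show 2 * (n + 1) = 2 * n + 1 + 1 by ring, sum_range_succ, sum_range_succ, ih]
    rw [show 2 * n + 1 = 2 * n + 1 by rfl, pow_succ, pow_mul]
    norm_num

/-- SECOND LAYER OF THE BASE-POINT HULL `M_𝔞` (report LEMMA 1.3): five minimal generators of signs `(2₊, 3₋)`, four independent linear parts
of relations of signs `(−,+,+,−)`; `dim 𝔪M/𝔪²M = 4·5 − 4 = 16` splitting as `(+) = 4·3 − 2 = 10` (odd coordinates times the three `(−)`
generators, minus the two `(+)` relations) and `(−) = 4·2 − 2 = 6`; so `M/𝔪²M` has signs `(2 + 10, 3 + 6) = (12, 9)`. Machine: `qd_node.py`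
PART A prints `(2,3)/(12,9)` for eight base ideals over the A₁ equation and for the A₃ equation. [folklore] -/
theorem secondLayer_base :
    4 * 5 - 4 = 16 ∧ 4 * 3 - 2 = 10 ∧ 4 * 2 - 2 = 6 ∧ 10 + 6 = 16 ∧ 2 + 10 = 12 ∧ 3 + 6 = 9 := by
  norm_num

/-- SECOND LAYER OF THE NON-BASE-POINT HULL `M⁰ = 𝓘_S e₊ ⊕ A e'` (report LEMMA 1.3): generators `e' (−), x₄e₊ (−), qe₊ (+)`, one Koszul
relation with linear part `−x₄ ⊗ (qe₊)` of sign `−`; `dim 𝔪M⁰/𝔪²M⁰ = 12 − 1 = 11 = 8₊ + 3₋`, `M⁰/𝔪²M⁰ = (1 + 8, 2 + 3) = (9, 5)`. [folklore] -/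
theorem secondLayer_nobase :
    4 * 3 - 1 = 11 ∧ 4 * 2 = 8 ∧ 4 * 1 - 1 = 3 ∧ 8 + 3 = 11 ∧ 1 + 8 = 9 ∧ 2 + 3 = 5 := by
  norm_num

/-- GENERATOR BOUND (report LEMMA 3.1): `μ_ε(F) = dim (F/𝔪F)_ε ≥ dim F̄_ε − dim (𝔪F̄)_ε` with `F̄ = (F + 𝔪²M)/𝔪²M`,
`dim F̄_ε = c_ε − p_ε` (`c` = signs of `M/𝔪²M`, `p` = signs of `T₀/𝔪²T₀`) and `dim (𝔪F̄)_ε ≤ 4·k` where `k = m_{−ε} − a_{−ε}` is the number of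
top classes of `F` of the opposite sign (the four coordinates are odd). Conclusion: `μ_ε(F) ≥ c_ε − p_ε − 4k`. For `M_𝔞` this is
`μ₊ ≥ 12 − p₊ − 4(3 − a₋) = 4a₋ − p₊`, `μ₋ ≥ 9 − p₋ − 4(2 − a₊) = 1 + 4a₊ − p₋`; for `M⁰`: `μ₊ ≥ 1 + 4a₋ − p₊`, `μ₋ ≥ 1 + 4a₊ − p₋`. [folklore] -/
theorem muBound (μ dF dmF c p k : ℤ) (h1 : dF - dmF ≤ μ) (h2 : dF = c - p) (h3 : dmF ≤ 4 * k) :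
    c - p - 4 * k ≤ μ := by
  omega

/-- The two instances of `muBound` used in the report (3.1): the `M_𝔞` bounds `4a₋ − p₊` and `1 + 4a₊ − p₋`, and the `M⁰` bounds
`1 + 4a₋ − p₊`, `1 + 4a₊ − p₋`, as identities. [folklore] -/
theorem muBound_instances (ap am pp pm : ℤ) :
    12 - pp - 4 * (3 - am) = 4 * am - pp ∧ 9 - pm - 4 * (2 - ap) = 1 + 4 * ap - pm ∧
    9 - pp - 4 * (2 - am) = 1 + 4 * am - pp ∧ 5 - pm - 4 * (1 - ap) = 1 + 4 * ap - pm := by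
  refine ⟨by ring, by ring, by ring, by ring⟩

/-- THE (S)-SIEVE, `(+)`-SOCLE CASE ON `M_𝔞` (report 3.3): a socle element of sign `+` gives a socle-line family of dimension `μ₊(F) ≥ 4a₋ − p₊`
(pv3-g9 (S), certified R288), so the point is dead unless `4a₋ − p₊ ≤ 1`; with `p₊ ≤ n ≤ 3` this forces `a₋ = 0` or `(a₋ = 1 ∧ p₊ = 3)`.
[folklore] -/
theorem sievePlus_survivor (a p : ℕ) (hp : p ≤ 3) (h : 4 * (a : ℤ) - p ≤ 1) : a = 0 ∨ (a = 1 ∧ p = 3) := by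
  omega

/-- THE (S)-SIEVE, `(−)`-SOCLE CASE ON `M_𝔞` AND BOTH CASES ON `M⁰` (report 3.3): the bound reads `1 + 4a − p ≤ 1` with `p ≤ 3`, forcing `a = 0`
(`a = a₊` for a `(−)`-socle element on `M_𝔞`; `a = a_{−ε}` for an `ε`-socle element on `M⁰`). [folklore] -/
theorem sieveMinus_survivor (a p : ℕ) (hp : p ≤ 3) (h : 1 + 4 * (a : ℤ) - p ≤ 1) : a = 0 := by
  omega

/-- INDEX BALANCE AT THE FIXED POINT (report 1.4): `t_x(F) = t_x(E) = 0` and `t_x(i_*𝒪_S) = 0` give `16(n₊ − n₋) = ±16(m₊ − m₋)`, where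
`(m₊, m₋)` are the even/odd lengths of `𝒪_S/𝔞`; THEOREM A gives `m₊ = m₋`, hence `n₊ = n₋`. [folklore] -/
theorem balanced_of_index (np nm mp mm s : ℤ) (hs : s = 1 ∨ s = -1) (h : 16 * (np - nm) = s * (16 * (mp - mm)))
    (hA : mp = mm) : np = nm := by
  rcases hs with rfl | rfl <;> · subst hA; simp at h; linarith

/-- THE HODGE-INDEX BUDGET (H2-ZERO-ONE-3 §5.3, re-derived): `N·θ_S = 16`, `θ_S² = 24`, `N² = 2t − 4 − 2c_K ≥ 2t − 4` and
`N²·θ_S² ≤ (N·θ_S)²` give `24·(2t − 4) ≤ 256`, i.e. `t ≤ 7`. [folklore] -/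
theorem hodgeBudget_seven (t N2 : ℤ) (hN : 2 * t - 4 ≤ N2) (hHI : 24 * N2 ≤ 256) : t ≤ 7 := by
  omega

/-- THE TORSION LENGTHS AT A FIXED POINT (report 2.3): `2 ≤ t ≤ 7` ((R-tan) + Hodge budget) and `t = 2n` even (THEOREM A) leave
`t ∈ {2, 4, 6}`, `n ∈ {1, 2, 3}`. [folklore] -/
theorem torsionLength_cases (t n : ℕ) (h2 : 2 ≤ t) (h7 : t ≤ 7) (he : t = 2 * n) : (t = 2 ∨ t = 4 ∨ t = 6) ∧ (n = 1 ∨ n = 2 ∨ n = 3) := by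
  omega

/-- BALANCED CYCLIC SHAPES, `t = 2` and `t = 4` (report 3.4): Hilbert functions `h = (1, h₁, h₂, h₃)` of a cyclic `ι`-module `A/I` of
length `2n` with alternating signs and equal sign-lengths (`1 + h₂ = h₁ + h₃`). Contiguity and Macaulay's growth bound are used in the weak
linear form `h_{i+1} ≤ 2h_i − 1` (truncated subtraction; for `i ≥ 1` this follows from `h_i = 0 ⟹ h_{i+1} = 0`, `h_i = 1 ⟹ h_{i+1} ≤ 1` and
`h_{i+1} ≤ h_i^{⟨i⟩} ≤ 2h_i − 1` for `2 ≤ h_i ≤ 4` within total length `≤ 6`). Result: for `n = 1` only `(1,1)`; for `n = 2` only `(1,2,1)` and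
`(1,1,1,1)` (not `(1,3)`, which has signs `(1,3)`). [folklore] -/
theorem hf_balanced_four (h1 h2 h3 : ℕ) (hsum : 1 + h1 + h2 + h3 = 4) (hg3 : h3 ≤ 2 * h2 - 1)
    (hbal : 1 + h2 = h1 + h3) : (h1 = 2 ∧ h2 = 1 ∧ h3 = 0) ∨ (h1 = 1 ∧ h2 = 1 ∧ h3 = 1) := by
  omega

/-- (the `t = 2` case: `1 + h₁ = 2`, balanced `1 = h₁`: only `(1,1)`.) [folklore] -/
theorem hf_balanced_two (h1 h2 : ℕ) (hsum : 1 + h1 + h2 = 2) (hbal : 1 + h2 = h1) : h1 = 1 ∧ h2 = 0 := by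
  omega

/-- BALANCED CYCLIC SHAPES, `t = 6` (report 3.4): Hilbert functions `(1, h₁, …, h₅)` of a cyclic `ι`-module `A/I` of length 6,
`A = k[[x₁..x₄]]` (`h₁ ≤ 4`), with the growth bounds in the linear form `h_{i+1} ≤ 2h_i − 1` (`i ≥ 1`, see `hf_balanced_four`) and balanced
(`1 + h₂ + h₄ = h₁ + h₃ + h₅`): exactly `(1,3,2)`, `(1,2,2,1)`, `(1,2,1,1,1)`, `(1,1,1,1,1,1)` — with signs alternating from the generator's,
the cyclic survivors of the (S)-sieve are those with an odd number of layers, `(1,3,2)` and `(1,2,1,1,1)` (and `(1,2,1)` for `t = 4`). [folklore] -/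
theorem hf_balanced_six (h1 h2 h3 h4 h5 : ℕ) (hsum : 1 + h1 + h2 + h3 + h4 + h5 = 6) (hm1 : h1 ≤ 4)
    (hg2 : h2 ≤ 2 * h1 - 1) (hg3 : h3 ≤ 2 * h2 - 1) (hg4 : h4 ≤ 2 * h3 - 1) (hg5 : h5 ≤ 2 * h4 - 1)
    (hbal : 1 + h2 + h4 = h1 + h3 + h5) :
    (h1, h2, h3, h4, h5) ∈ [((3 : ℕ), (2 : ℕ), (0 : ℕ), (0 : ℕ), (0 : ℕ)), (2, 2, 1, 0, 0), (2, 1, 1, 1, 0), (1, 1, 1, 1, 1)] := by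
  have b1 : h1 ≤ 3 := by omega
  have b2 : h2 ≤ 2 := by omega
  have b3 : h3 ≤ 3 := by omega
  have b4 : h4 ≤ 2 := by omega
  have b5 : h5 ≤ 3 := by omega
  interval_cases h1 <;> interval_cases h2 <;> interval_cases h3 <;> interval_cases h4 <;> interval_cases h5 <;>
    first | decide | (exfalso; omega)

/-- THE (Ψ)-COUNT OVER `M₁ = 𝔪M` (report LEMMA 3.2) on the surviving cyclic shapes: `h_Ψ = (m₊ − a₊)s₊ + (m₋ − a₋)s₋`. On `M_𝔞`
(`m = (2,3)`): a `(−)`-cyclic shape (`a = (0,1)`) whose last layer is `(−)` has `s₋ ≥ 1` and `h_Ψ ≥ 2·1 = 2` — dead; a `(+)`-cyclic shape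
(`a = (1,0)`) gets only `h_Ψ ≥ 1·s₊` — the shapes `(+|−−|+)`, `(+|−−|+|−|+)` survive with `s₊ = 1` and die with `s₊ ≥ 2` (e.g. `(1,3,2)₊`). On
`M⁰` (`m = (1,2)`) the coefficients are `(1 − a₊, 2 − a₋)`. [folklore] -/
theorem psiCount_cyclic (sp sm : ℕ) (hsm : 1 ≤ sm) (hsp : 2 ≤ sp) :
    2 ≤ (2 - 0) * sp + (3 - 1) * sm ∧ 2 ≤ (2 - 1) * sp + (3 - 0) * 0 ∧ (2 - 1) * 1 + (3 - 0) * 0 = 1 ∧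
    2 ≤ (1 - 0) * 0 + (2 - 1) * 2 ∧ (1 - 1) * sp + (2 - 0) * 0 = 0 := by
  omega

/-- THE (P)-COUNTS ON `M_𝔞` (report §4; `d ≥ hom − aut`, pv3-g9 (P), certified R288; `hom` = dimension of the solution space of the four
relation equations (E1)–(E4) in `5n` unknowns, `aut = dim End_A(T₀)^ι`): `(+|−−|+)` Gorenstein, `n = 2`: `hom ≥ 10 − 1 − 2 = 7`, `aut = 2`,
`d ≥ 5`; `(++|−−−|+)`, `n = 3`: `hom ≥ 15 − 1 − 1 − 1 = 12`, `aut ∈ {3, 5}`, `d ≥ 7`; `(−−|+++|−)`: `hom ≥ 15 − 1 − 1 − 2 − 3 = 8` with `aut = 3`,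
or `hom ≥ 15 − 1 − 1 − 1 − 2 = 10` with `aut = 5`: `d ≥ 5`; `(+|−−|+|−|+)` Gorenstein: `hom ≥ 15 − 1 − 1 − 1 − 2 − 2 = 8`, `aut = 3`, `d ≥ 5`.
Machine (`qd_node.py` PART C, minima over samples): 7 − 2 = 5; 12 − 3 = 9 / 12 − 5 = 7; 10 − 3 = 7; 9 − 3 = 6. [folklore] -/
theorem pCounts_base :
    (10 - 1 - 2 : ℤ) - 2 = 5 ∧ (15 - 1 - 1 - 1 : ℤ) - 3 = 9 ∧ (15 - 1 - 1 - 1 : ℤ) - 5 = 7 ∧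
    (15 - 1 - 1 - 2 - 3 : ℤ) - 3 = 5 ∧ (15 - 1 - 1 - 1 - 2 : ℤ) - 5 = 5 ∧ (15 - 1 - 1 - 1 - 2 - 2 : ℤ) - 3 = 5 := by
  norm_num

/-- THE (P)-COUNTS ON `M⁰` (report §4.5; one relation (E0) in `3n` unknowns, `aut = n` for cyclic `T₀`): `(+|−−|+)`: `hom = 6`, `d ≥ 4`;
`(−|++|−)`: `hom ≥ 5`, `d ≥ 3`; every cyclic shape with `n = 3`: `hom ≥ 9 − 3 = 6`, `d ≥ 3`; `(−−|+++|−)`: `hom ≥ 9 − 1 = 8`, `aut ≤ 5`,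
`d ≥ 3`. Machine minima: 4, 3, 4, 5 / 3. [folklore] -/
theorem pCounts_nobase :
    (6 : ℤ) - 2 = 4 ∧ (6 - 1 : ℤ) - 2 = 3 ∧ (9 - 3 : ℤ) - 3 = 3 ∧ (9 - 1 : ℤ) - 5 = 3 ∧ (9 - 1 : ℤ) - 3 = 5 := by
  norm_num

/-- ERRATUM E8's COLENGTH ARITHMETIC (report §7.1): in `R = k[[x₁,x₂,x₃]]/(x₁x₂ − x₃²)` the 'bent curvilinear' ideal `(x₃, x₁ − x₂³)` has
`R/(x₃) = k[[x₁,x₂]]/(x₁x₂)` and then `x₁ = x₂³` gives `k[x₂]/(x₂·x₂³) = k[x₂]/(x₂⁴)`: colength `1 + 3 = 4`, standard monomials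
`1, x₂, x₂², x₂³` of signs `(2, 2)`; the 'ruling + 𝔪²' ideal `(x₁, x₃, x₂²)` has colength `2`, signs `(1,1)`. Both classes are missing from
H2-ZERO-ONE-3 §11.2; with them the colength-4 `ι`-stable ideals form `7` classes (`𝔪²` and six balanced ones), of which the 2-generated
`(even, odd)` ones are `T1` and `T2` (`= T2a ≅ T2b`). [folklore] -/
theorem erratumE8_counts : 1 + 3 = 4 ∧ (2 : ℕ) = 1 + 1 ∧ 1 + 4 + 2 = 7 ∧ 7 - 1 = 6 := by
  norm_num

end H2QuotSieveFixedNode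

/-!
## ADDENDUM 1 (same seat; report §14): fixed points of type `A_{2m−1}` with NON-Cartier index-0 `N`, and the sieve in uniform form

At an `ι`-fixed singular point of type `A_{2m−1}` (`S = V(x₄, uv − w^{2m})`, all coordinates odd; `m = 1` is the node, `m = 2` the A₃ point of
H2-ZERO-ONE-3 §12.5) the rank-one reflexive modules are `M_j = (u, w^j)𝒪_S`, `0 ≤ j < 2m`; with the odd one-parameter subgroup of weights
`(2m−1, 1, 1, 1)` (so `ι = λ(−1)`) the Hilbert numerator of `M_j` over `k[[u,v,w]]` is `N_j(s) = s^{2m−1} + s^j − s^{2m} − s^{2m−1+j}`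
(generators `u`, `w^j`; matrix-factorisation relations of weights `2m`, `2m−1+j`), and the local `ι`-index is `2·N_j(−1) = 4((−1)^j − 1)`:
**index 0 iff `j` is even** (`indexTable_A_even/_odd`; A₁: only `𝒪_S`; A₃: `𝒪_S` and `M₂` — §12.6's table). THEOREM A′ (report 14.2): for every
index-0 `N_x` the quotient `N_x/G_x` and the torsion `T₀,x` are BALANCED — by additivity of the index over `0 → K → E_S → G → 0`,
`0 → G → N → N/G → 0` with `K` reflexive of class `−[N]` (index 0 again) and `t_x(𝒪_S) = 0`. THE SIEVE IN UNIFORM FORM (report 14.3): for a hull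
with minimal generators of signs `(m₊, m₋)` (`m_ε ≤ 3`) and minimal relations of signs `(ρ₊, ρ₋)` with independent linear parts, `κ_ε = m_ε − ρ_ε ≥ 0`,
every point of `Quot^ι_x(M; n,n)`, `n ≤ 3`, has local dimension `≥ 2` as soon as `P_cyc(σ,n) = n(m₊+m₋−ρ_{−σ}−1) − ρ_σ(n−1) ≥ 2` for the `σ` with
`m_σ ≤ 2` (`n = 2, 3`) and `P_two(σ) = 3(m₊+m₋) − ρ_σ − min(3ρ_{−σ}, 2m_σ−1) − 5 ≥ 2` for the `σ` with `2 ≤ m_σ ≤ 3`. THE HULL at a fixed `A_{2m−1}`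
point with `N_x ≅ M_j`, `j` even `≠ 0` (report 14.4) has `(m; ρ) ∈ {(2,2;1,1) NB, (3,2;2,2), (2,3;2,2), (3,3;3,3)}`; with the Cartier hulls
`(2,3;2,2)` and `(1,2;0,1)` these are six types, and the table `decisionTable_uniform` shows all pass. Hence (report 14.5) every configuration with
torsion at fixed points of type A is VOID; what is left of the theta-c.i. family on the very general `X` is (W)″ = corank-≥2 fixed points with
non-Cartier index-0 `N`.
-/

section H2QuotSieveUniform

/-- INDEX TABLE AT A FIXED `A_{2m−1}` POINT, even class (report 14.1): for `j = 2i` the Hilbert numerator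
`N_j(s) = s^{2m−1} + s^{j} − s^{2m} − s^{2m−1+j}` vanishes at `s = −1` (here `m = k + 1 ≥ 1`), so `t_x(i_*M_j) = 2·N_j(−1) = 0`: `M_{2i}` has index 0
(`M₀ = 𝒪_S`; at A₃ also `M₂`). [folklore] -/
theorem indexTable_A_even (k i : ℕ) :
    (-1 : ℤ) ^ (2 * k + 1) + (-1) ^ (2 * i) - (-1) ^ (2 * k + 2) - (-1) ^ (2 * k + 1 + 2 * i) = 0 := by
  simp [pow_add, pow_mul]

/-- INDEX TABLE AT A FIXED `A_{2m−1}` POINT, odd class (report 14.1): for `j = 2i + 1`, `N_j(−1) = −4`, so `t_x(i_*M_j) = 2·(−4) = −8 ≠ 0`: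
the odd classes `M_{2i+1}` (the rulings `M₁`, `M₃` at A₃; `M` at A₁) violate `t ≡ 0` — (C12) and §12.6 in closed form. [folklore] -/
theorem indexTable_A_odd (k i : ℕ) :
    (-1 : ℤ) ^ (2 * k + 1) + (-1) ^ (2 * i + 1) - (-1) ^ (2 * k + 2) - (-1) ^ (2 * k + 1 + (2 * i + 1)) = -4 ∧ (2 : ℤ) * (-4) = -8 := by
  refine ⟨?_, by norm_num⟩
  have h : 2 * k + 1 + (2 * i + 1) = 2 * (k + i + 1) := by ring
  rw [h]
  simp [pow_add, pow_mul]

/-- INDEX ADDITIVITY ⟹ BALANCE (report 14.2, THEOREM A′): with `t(E_S) = t(𝒪_S)·(1 − 1)`-type cancellations — concretely `t(K) = 0`,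
`t(E_S) = 0` give `t(G) = t(E_S) − t(K) = 0`, then `t(N/G) = t(N) − t(G) = 0`, and `t(T₀) = −t(G) = 0`; with `t(finite) = 16(n₊ − n₋)`:
`n₊ = n₋`. [folklore] -/
theorem balance_by_additivity (tK tE tG tN tQ tT np nm : ℤ) (hK : tK = 0) (hE : tE = 0) (hN : tN = 0)
    (h1 : tG = tE - tK) (h2 : tQ = tN - tG) (h3 : tT + tG = 0) (hT : tT = 16 * (np - nm)) : tQ = 0 ∧ np = nm := by
  constructor <;> omega

/-- THE SECOND-LAYER CONSTANT FROM `(m, ρ)` (report 14.3): `dim(𝔪M/𝔪²M)_ε = 4m_{−ε} − ρ_ε` and `c_ε = m_ε + 4m_{−ε} − ρ_ε`; the six hull types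
give `c` = (12,9), (9,5), (9,9), (9,12), (12,9), (12,12). [folklore] -/
theorem secondLayer_from_m_rho :
    (2 + 4 * 3 - 2 = 12 ∧ 3 + 4 * 2 - 2 = 9) ∧ (1 + 4 * 2 - 0 = 9 ∧ 2 + 4 * 1 - 1 = 5) ∧ (2 + 4 * 2 - 1 = 9) ∧
    (3 + 4 * 2 - 2 = 9 ∧ 2 + 4 * 3 - 2 = 12) ∧ (3 + 4 * 3 - 3 = 12) := by
  norm_num

/-- THE UNIFORM (S)-SIEVE (report 14.3): `μ_ε(F) ≥ κ_ε + 4a_{−ε} − p_ε` with `κ_ε = m_ε − ρ_ε ∈ {0, 1}` and `p_ε ≤ 3`; a socle element of sign `ε`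
is fatal unless `κ_ε + 4a − p ≤ 1`, i.e. `a = 0` or (`a = 1 ∧ p = 3 ∧ κ = 0`). [folklore] -/
theorem sieve_uniform (κ a p : ℕ) (hκ : κ ≤ 1) (hp : p ≤ 3) (h : (κ : ℤ) + 4 * a - p ≤ 1) : a = 0 ∨ (a = 1 ∧ p = 3 ∧ κ = 0) := by
  omega

/-- THE DECISION TABLE (report 14.3): `P_cyc(σ,n) = n(m₊ + m₋ − ρ_{−σ} − 1) − ρ_σ(n − 1)` and
`P_two(σ) = 3(m₊ + m₋) − ρ_σ − min(3ρ_{−σ}, 2m_σ − 1) − 5` for the six hull types `(m₊,m₋;ρ₊,ρ₋)` =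
Cartier base point (2,3;2,2), Cartier non-base (1,2;0,1), NB (2,2;1,1), '+' (3,2;2,2), '−' (2,3;2,2) (mirror), 'd' (3,3;3,3): every cyclic bound needed
(those `σ` with `m_σ ≤ 2`) is `≥ 2` for all `n ≥ 1` resp. `n ≥ 2`, and every two-generator bound is `≥ 2`; the `min` values used are evaluated first. [folklore] -/
theorem decisionTable_uniform :
    (min 6 3 = 3 ∧ min 6 5 = 5 ∧ min 0 3 = 0 ∧ min 3 3 = 3 ∧ min 9 5 = 5) ∧
    -- Cartier base point (2,3;2,2): P_cyc(+,n) = n(5-2-1) - 2(n-1) = 2; P_two(+) = 15-2-3-5 = 5; P_two(-) = 15-2-5-5 = 3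
    (∀ n : ℤ, n * (5 - 2 - 1) - 2 * (n - 1) = 2) ∧ ((15 : ℤ) - 2 - 3 - 5 = 5) ∧ ((15 : ℤ) - 2 - 5 - 5 = 3) ∧
    -- Cartier non-base point (1,2;0,1): P_cyc(+,n) = n(3-1-1) - 0 = n; P_cyc(-,n) = n(3-0-1) - 1(n-1) = n + 1; P_two(-) = 9-1-0-5 = 3
    (∀ n : ℤ, n * (3 - 1 - 1) - 0 * (n - 1) = n ∧ n * (3 - 0 - 1) - 1 * (n - 1) = n + 1) ∧ ((9 : ℤ) - 1 - 0 - 5 = 3) ∧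
    -- NB (2,2;1,1): P_cyc = n(4-1-1) - (n-1) = n + 1; P_two = 12-1-3-5 = 3
    (∀ n : ℤ, n * (4 - 1 - 1) - 1 * (n - 1) = n + 1) ∧ ((12 : ℤ) - 1 - 3 - 5 = 3) ∧
    -- type '+' (3,2;2,2): P_cyc(-,n) = n(5-2-1) - 2(n-1) = 2; P_two(+) = 15-2-5-5 = 3; P_two(-) = 15-2-3-5 = 5
    (∀ n : ℤ, n * (5 - 2 - 1) - 2 * (n - 1) = 2) ∧ ((15 : ℤ) - 2 - 5 - 5 = 3) ∧ ((15 : ℤ) - 2 - 3 - 5 = 5) ∧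
    -- type 'd' (3,3;3,3): no cyclic survivors (m_σ = 3); P_two = 18-3-5-5 = 5
    ((18 : ℤ) - 3 - 5 - 5 = 5) := by
  refine ⟨by decide, fun n => by ring, by norm_num, by norm_num, fun n => ⟨by ring, by ring⟩, by norm_num, fun n => by ring, by norm_num,
    fun n => by ring, by norm_num, by norm_num, by norm_num⟩

/-- β₁ OF THE HULL (report 14.4 (d)): `β₁^A(M) = dim Tor₁^A(M₀,k) = β₁^{B₀}(M₀) + β₀^{B₀}(M₀) = (μ(M₀) − 2) + μ(M₀) = 2μ(M₀) − 2`, i.e. `2, 4, 4, 6`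
minimal relations for `μ(M₀) = 2, 3, 3, 4` (types NB, '+', '−', 'd'), and `μ(M) = μ(M₀) + 2 = 4, 5, 5, 6`. [folklore] -/
theorem betaOne_hull (μ0 : ℕ) (h : 2 ≤ μ0) : (μ0 - 2) + μ0 = 2 * μ0 - 2 ∧ (2 * 2 - 2 = 2 ∧ 2 * 3 - 2 = 4 ∧ 2 * 4 - 2 = 6) := by
  omega

end H2QuotSieveUniform

end Literature.AlgebraicGeometry.HodgeTheory
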